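import Mathlib.LinearAlgebra.Matrix.Charpoly.Coeff      -- `charpoly_natDegree_eq_dim`, `aeval_self_charpoly`, `eval_charpoly`, `adjugate_fin_three`
import Mathlib.LinearAlgebra.Matrix.ToLinearEquiv       -- `Matrix.exists_mulVec_eq_zero_iff`
import Mathlib.LinearAlgebra.Basis.VectorSpace          -- `Submodule.exists_le_ker_of_lt_top`
import Mathlib.Algebra.Polynomial.Degree.SmallDegree    -- `eq_X_add_C_of_natDegree_le_one`, `degree_linear_le`
import Mathlib.Algebra.Polynomial.FieldDivision        -- `exists_root_of_degree_eq_one`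
import Mathlib.Tactic.Module
import Mathlib.Tactic.LinearCombination
import HarnessLib

/-!
# The Chevalley map of `M₃`: exact first-order expansion of `(tr, tr ∘ adj, det)`, the regularity criterion
# «`1, X, X²` independent ⟺ no quadratic relation `(X − a)(X − b) = 0`», and «the differential is onto ⟺ `X` is regular»

ROAD «HC-D» (cell `pub/hodgecm-mathlib`, crux H413 = `stmt-HodgeConjecture-24833`, lane `--supports … --as helper`), brick (D4a) «REGULARITY CRITERION +
CHEVALLEY DIFFERENTIAL», dealt BY NAME by the road holder F0P2-p01 (g23) (bus F0∕P2 2026-09-02T16:05:00Z DEAL #1) to LH1-p03 (g9).  THEOREMS ONLY (no definition ∕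
instance ∕ notation ∕ named fact ∕ `sorry`); generic linear algebra over a commutative ring `R` (§1) or a field `K` (§2–§3), Mathlib-only imports; the descent to the
skew-hermitian `F`-form `𝔲(J)` (the Lie algebra of the unitary group) is the sequel `Summits/…/Theorems/F0P3cStCharTSChevalleyDifferential.lean`.

For `X : Matrix (Fin 3) (Fin 3) R` the CHEVALLEY MAP is `χ(X) = (tr X, tr adj X, det X)` — the coefficients of `p_X(t) = t³ − tr X·t² + tr adj X·t − det X`
(★ `Literature.LinearAlgebra.Matrix.charpoly_fin_three` of ROAD brick D6(b) `CayleyCharpolyDiscr` (F0P2-p06 g18), ★ `CharpolyBlockPatterns.charpoly_fin_three_trace_adjugate`;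
[HornJohnson2013 §1.2 (1.2.13), `tr adj A = E_{n−1}(A)`]) — NOT retyped here: the heads below speak of `trace`, `trace ∘ adjugate`, `det` directly, so `charpoly` never
appears in a statement and the consumer rewrites once by either ★ lemma (`η = δ ∘ χ` is then Mathlib `discr_of_degree_eq_three`, as in ★ DG-FIELD).

* §1 (any commutative ring) EXACT EXPANSIONS: `adjugate_eq_sq_sub_trace_smul_add` (`adj X = X² − tr X·X + tr adj X·1`, Cayley–Hamilton for `n = 3`),
  `trace_adjugate_add` (`tr adj (X+Y) = tr adj X + (tr X·tr Y − tr (XY)) + tr adj Y`), `det_add_eq_fin_three` (`det (X+Y) = det X + tr (adj X·Y) + tr (adj Y·X) + det Y`,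
  Jacobi's formula (0.8.10.1) with its exact remainder), `trace_trace_smul_one_sub_mul` (`tr ((tr X·1 − X) Y) = tr X·tr Y − tr (XY)`).  So
  `χ(X + Y) = χ(X) + L_X(Y) + (0, tr adj Y, tr (adj Y·X) + det Y)` with the DIFFERENTIAL `L_X(Y) = (tr Y, tr X·tr Y − tr (XY), tr (adj X·Y))`, whose three components are
  the trace pairings `Y ↦ tr (A Y)` against the GRADIENTS `A = 1, tr X·1 − X, adj X`.
* §2 (field) REGULARITY: `exists_mul_sub_eq_zero_iff_not_linearIndependent` («`∃ a b, (X − a·1)(X − b·1) = 0` ⟺ `1, X, X²` are dependent»; the splitting of a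
  quadratic annihilator uses an eigenvector for the linear cofactor of `p_X`), its negation `not_exists_mul_sub_eq_zero_iff_linearIndependent`, and
  `linearIndependent_gradients_iff` (`1, tr X·1 − X, adj X` independent ⟺ `1, X, X²` independent).
* §3 (field) SURJECTIVITY ⟺ REGULARITY: `eq_zero_of_forall_trace_mul_eq_zero` (the trace pairing is perfect), `surjective_differential_iff` (`L_X : M₃(K) → K³` onto ⟺
  `1, X, X²` independent) and the trace-zero form `forall_exists_trace_zero_differential_iff` (for every `(c, d)` a `Y` with `tr Y = 0` — the slice `𝔰𝔩₃`).

## References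
* [HornJohnson2013] R. A. Horn, C. R. Johnson, *Matrix Analysis*, 2nd ed., CUP 2013 (held `book:horn2012-matrix-analysis`): §0.8.10 (0.8.10.1) (`d det = tr(adj A dA)`),
  §1.2 Def. 1.2.10–(1.2.13) (`E_k`, `tr adj A = E_{n−1}(A)`), Thm. 3.3.15 (nonderogatory ⟺ `deg q_A = n` ⟺ similar to the companion matrix).
* B. Kostant, *Lie group representations on polynomial rings*, Amer. J. Math. 85 (1963), Thm. 0.1 (regular ⟺ the differentials of the invariants are independent) — context.
-/

set_option autoImplicit false

open Matrix Polynomial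

namespace Literature.LinearAlgebra.Matrix.CubicChevalleyDifferential

/-! ## §1 Exact expansions over a commutative ring -/

section CommRing

variable {R : Type*} [CommRing R]

/-- **Cayley–Hamilton for `n = 3`, adjugate form**: `adj X = X² − tr X · X + tr adj X · 1`. [cite: HornJohnson2013, §1.2 (1.2.13); Thm. 2.4.3.2 (Cayley–Hamilton)] -/
theorem adjugate_eq_sq_sub_trace_smul_add (X : Matrix (Fin 3) (Fin 3) R) :
    adjugate X = X ^ 2 - trace X • X + trace (adjugate X) • (1 : Matrix (Fin 3) (Fin 3) R) := by
  ext i j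
  rw [adjugate_fin_three, trace_fin_three, sq]
  fin_cases i <;> fin_cases j <;>
    simp [Matrix.mul_apply, Fin.sum_univ_three] <;> ring

/-- **Polarisation of `E₂ = tr ∘ adj`** (exact): `tr adj (X + Y) = tr adj X + (tr X · tr Y − tr (X Y)) + tr adj Y`. [cite: HornJohnson2013, §1.2 Def. 1.2.10–(1.2.13)] -/
theorem trace_adjugate_add (X Y : Matrix (Fin 3) (Fin 3) R) :
    trace (adjugate (X + Y)) = trace (adjugate X) + (trace X * trace Y - trace (X * Y)) + trace (adjugate Y) := by
  simp [trace_fin_three, adjugate_fin_three, Matrix.add_apply, Matrix.mul_apply, Fin.sum_univ_three]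
  ring

/-- **Jacobi's formula with exact remainder, `n = 3`**: `det (X + Y) = det X + tr (adj X · Y) + tr (adj Y · X) + det Y`. [cite: HornJohnson2013, §0.8.10 (0.8.10.1)] -/
theorem det_add_eq_fin_three (X Y : Matrix (Fin 3) (Fin 3) R) :
    det (X + Y) = det X + trace (adjugate X * Y) + trace (adjugate Y * X) + det Y := by
  simp only [det_fin_three, trace_fin_three, Matrix.add_apply, Matrix.mul_apply, Fin.sum_univ_three]
  simp [adjugate_fin_three]
  ring

/-- The middle component of the differential as a trace pairing: `tr ((tr X·1 − X)·Y) = tr X·tr Y − tr (X Y)`. [cite: HornJohnson2013, §1.2 (1.2.13)] -/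
theorem trace_trace_smul_one_sub_mul (X Y : Matrix (Fin 3) (Fin 3) R) :
    trace ((trace X • (1 : Matrix (Fin 3) (Fin 3) R) - X) * Y) = trace X * trace Y - trace (X * Y) := by
  rw [sub_mul, smul_mul_assoc, one_mul, trace_sub, trace_smul, smul_eq_mul]

/-- The symmetric spelling of the mixed term: `tr (adj X · Y) = tr (Y · adj X)`. [cite: HornJohnson2013, §0.8.10 (0.8.10.1)] -/
theorem trace_adjugate_mul_comm (X Y : Matrix (Fin 3) (Fin 3) R) : trace (adjugate X * Y) = trace (Y * adjugate X) :=
  Matrix.trace_mul_comm _ _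

end CommRing

/-! ## §2 Regularity: `1, X, X²` independent ⟺ no quadratic relation `(X − a)(X − b) = 0` -/

section Field

variable {K : Type*} [Field K]

/-- A quadratic relation gives a dependence of `1, X, X²`. [cite: HornJohnson2013, Thm. 3.3.15] -/
theorem not_linearIndependent_of_mul_sub_eq_zero {X : Matrix (Fin 3) (Fin 3) K} {a b : K}
    (h : (X - a • (1 : Matrix (Fin 3) (Fin 3) K)) * (X - b • (1 : Matrix (Fin 3) (Fin 3) K)) = 0) :
    ¬ LinearIndependent K ![(1 : Matrix (Fin 3) (Fin 3) K), X, X ^ 2] := by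
  rw [Fintype.not_linearIndependent_iff]
  refine ⟨![a * b, -(a + b), 1], ?_, 2, by simp⟩
  have key : (a * b) • (1 : Matrix (Fin 3) (Fin 3) K) + (-(a + b)) • X + (1 : K) • X ^ 2 = 0 := by
    rw [← h]
    simp only [sq, sub_mul, mul_sub, smul_mul_assoc, mul_smul_comm, one_mul, mul_one]
    module
  simpa [Fin.sum_univ_three] using key

/-- `c • 1 = 0` in `M₃(K)` forces `c = 0`. [folklore] -/
private theorem smul_one_eq_zero_iff (c : K) : c • (1 : Matrix (Fin 3) (Fin 3) K) = 0 ↔ c = 0 := by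
  refine ⟨fun h => ?_, fun h => by rw [h, zero_smul]⟩
  have h00 := congr_fun (congr_fun h 0) 0
  simpa using h00

/-- A scalar matrix satisfies a quadratic relation. [cite: HornJohnson2013, Thm. 3.3.15] -/
theorem exists_mul_sub_eq_zero_of_eq_smul_one {X : Matrix (Fin 3) (Fin 3) K} {a : K} (h : X = a • (1 : Matrix (Fin 3) (Fin 3) K)) :
    ∃ a' b : K, (X - a' • (1 : Matrix (Fin 3) (Fin 3) K)) * (X - b • (1 : Matrix (Fin 3) (Fin 3) K)) = 0 :=
  ⟨a, 0, by rw [h, sub_self, zero_mul]⟩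

/-- If `c₁ • X + c₀ • 1 = 0` with `c₁ ≠ 0` then `X` is scalar. [folklore] -/
private theorem eq_smul_one_of_smul_add_smul_one_eq_zero {X : Matrix (Fin 3) (Fin 3) K} {c₁ c₀ : K} (hc : c₁ ≠ 0)
    (h : c₁ • X + c₀ • (1 : Matrix (Fin 3) (Fin 3) K) = 0) : X = (-(c₀ / c₁)) • (1 : Matrix (Fin 3) (Fin 3) K) := by
  have h' : c₁ • X = -(c₀ • (1 : Matrix (Fin 3) (Fin 3) K)) := eq_neg_of_add_eq_zero_left h
  calc X = c₁⁻¹ • (c₁ • X) := by rw [smul_smul, inv_mul_cancel₀ hc, one_smul]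
    _ = _ := by rw [h', smul_neg, smul_smul, neg_smul, div_eq_inv_mul]

/-- **A monic quadratic annihilator of a `3 × 3` matrix splits**: if `A² + p·A + r·1 = 0` then `(A − a)(A − b) = 0` for some `a, b ∈ K`.  Either `A` is scalar, or
`q = t² + p t + r` divides `p_A` (divide with remainder and evaluate at `A`), `p_A = q·ℓ` with `ℓ` linear; a root `a` of `ℓ` is an eigenvalue, and an eigenvector `v`
gives `q(a)·v = q(A)v = 0`, so `q(a) = 0` and `q = (t − a)(t − b)`, `b = −p − a`. [cite: HornJohnson2013, Thm. 3.3.15] -/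
theorem exists_mul_sub_eq_zero_of_sq_add (A : Matrix (Fin 3) (Fin 3) K) (p r : K)
    (h : A ^ 2 + p • A + r • (1 : Matrix (Fin 3) (Fin 3) K) = 0) :
    ∃ a b : K, (A - a • (1 : Matrix (Fin 3) (Fin 3) K)) * (A - b • (1 : Matrix (Fin 3) (Fin 3) K)) = 0 := by
  -- the quadratic `q` and its evaluation at `A`
  set q : K[X] := Polynomial.X ^ 2 + (C p * Polynomial.X + C r) with hq
  have hlin : (C p * Polynomial.X + C r).natDegree < (Polynomial.X ^ 2 : K[X]).natDegree := by
    rw [natDegree_X_pow]; exact natDegree_linear_le.trans_lt (by norm_num)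
  have hqdeg : q.natDegree = 2 := by
    rw [hq, natDegree_add_eq_left_of_natDegree_lt hlin, natDegree_X_pow]
  have hqm : q.Monic := by
    rw [hq]
    exact monic_X_pow_add (n := 2) (degree_linear_le.trans_lt (by exact_mod_cast (by norm_num : (1 : ℕ) < 2)))
  have haq : aeval A q = 0 := by
    rw [hq, map_add, map_add, map_pow, aeval_X, map_mul, aeval_C, aeval_X, aeval_C, Algebra.algebraMap_eq_smul_one, Algebra.algebraMap_eq_smul_one,
      smul_mul_assoc, one_mul, ← add_assoc]
    exact h
  -- reduction: a root `a ∈ K` of `q` finishes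
  have finish : ∀ a : K, a ^ 2 + p * a + r = 0 →
      ∃ a' b : K, (A - a' • (1 : Matrix (Fin 3) (Fin 3) K)) * (A - b • (1 : Matrix (Fin 3) (Fin 3) K)) = 0 := by
    intro a ha
    refine ⟨a, -p - a, ?_⟩
    have hr : r = -a ^ 2 - p * a := by linear_combination ha
    rw [← h, hr]
    simp only [sq, sub_mul, mul_sub, smul_mul_assoc, mul_smul_comm, one_mul, mul_one]
    module
  -- divide `p_A` by `q`; the remainder annihilates `A`
  set ρ : K[X] := A.charpoly %ₘ q with hρ
  have hρdeg : ρ.natDegree ≤ 1 := by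
    by_cases hρ0 : ρ = 0
    · rw [hρ0, natDegree_zero]; exact zero_le_one
    · have hlt : ρ.natDegree < q.natDegree := natDegree_lt_natDegree hρ0 (degree_modByMonic_lt _ hqm)
      omega
  have hρA : aeval A ρ = 0 := by
    rw [hρ, modByMonic_eq_sub_mul_div, map_sub, map_mul, Matrix.aeval_self_charpoly, haq, zero_mul, sub_zero]
  have hρeq := eq_X_add_C_of_natDegree_le_one hρdeg
  have hρA' : ρ.coeff 1 • A + ρ.coeff 0 • (1 : Matrix (Fin 3) (Fin 3) K) = 0 := by
    have := hρA
    rw [hρeq, map_add, map_mul, aeval_C, aeval_X, aeval_C, Algebra.algebraMap_eq_smul_one, Algebra.algebraMap_eq_smul_one, smul_mul_assoc, one_mul] at this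
    exact this
  by_cases h1 : ρ.coeff 1 = 0
  · -- `q ∣ p_A`
    rw [h1, zero_smul, zero_add, smul_one_eq_zero_iff] at hρA'
    have hρ0 : ρ = 0 := by rw [hρeq, h1, hρA', C_0, zero_mul, zero_add]
    obtain ⟨ℓ, hℓ⟩ := (modByMonic_eq_zero_iff_dvd hqm).1 hρ0
    -- `ℓ` is linear
    have hχdeg : A.charpoly.natDegree = 3 := by rw [charpoly_natDegree_eq_dim, Fintype.card_fin]
    have hℓ0 : ℓ ≠ 0 := by
      intro h0; rw [h0, mul_zero] at hℓ; exact (charpoly_monic A).ne_zero hℓ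
    have hℓdeg : ℓ.degree = 1 := by
      have hnat : (q * ℓ).natDegree = q.natDegree + ℓ.natDegree := natDegree_mul hqm.ne_zero hℓ0
      rw [← hℓ, hχdeg, hqdeg] at hnat
      rw [degree_eq_natDegree hℓ0]
      exact_mod_cast (by omega : ℓ.natDegree = 1)
    obtain ⟨a, ha⟩ := exists_root_of_degree_eq_one hℓdeg
    -- `a` is an eigenvalue of `A`
    have hχa : A.charpoly.IsRoot a := by rw [hℓ]; exact root_mul_left_of_isRoot q ha
    have hdet : (Matrix.scalar (Fin 3) a - A).det = 0 := by rw [← Matrix.eval_charpoly]; exact hχa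
    obtain ⟨v, hv0, hv⟩ := Matrix.exists_mulVec_eq_zero_iff.2 hdet
    have hAv : A *ᵥ v = a • v := by
      rw [scalar_apply, ← smul_one_eq_diagonal, sub_mulVec, smul_mulVec, one_mulVec, sub_eq_zero] at hv
      exact hv.symm
    -- `q(a) v = q(A) v = 0`
    have hA2v : (A ^ 2) *ᵥ v = (a ^ 2) • v := by
      rw [sq, sq, ← mulVec_mulVec, hAv, mulVec_smul, hAv, smul_smul]
    have hqv : (a ^ 2 + p * a + r) • v = 0 := by
      have := congr_arg (fun M : Matrix (Fin 3) (Fin 3) K => M *ᵥ v) h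
      rw [add_mulVec, add_mulVec, smul_mulVec, smul_mulVec, one_mulVec, zero_mulVec, hA2v, hAv, smul_smul] at this
      rw [add_smul, add_smul]
      exact this
    exact finish a ((smul_eq_zero.1 hqv).resolve_right hv0)
  · -- `A` is scalar
    exact exists_mul_sub_eq_zero_of_eq_smul_one (eq_smul_one_of_smul_add_smul_one_eq_zero h1 hρA')

/-- **REGULARITY CRITERION for `M₃(K)`** (any field): `(∃ a b, (X − a·1)(X − b·1) = 0) ⟺ ¬ (1, X, X² independent)`. [cite: HornJohnson2013, Thm. 3.3.15] -/
theorem exists_mul_sub_eq_zero_iff_not_linearIndependent (X : Matrix (Fin 3) (Fin 3) K) :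
    (∃ a b : K, (X - a • (1 : Matrix (Fin 3) (Fin 3) K)) * (X - b • (1 : Matrix (Fin 3) (Fin 3) K)) = 0) ↔
      ¬ LinearIndependent K ![(1 : Matrix (Fin 3) (Fin 3) K), X, X ^ 2] := by
  refine ⟨fun ⟨a, b, h⟩ => not_linearIndependent_of_mul_sub_eq_zero h, fun h => ?_⟩
  obtain ⟨g, hg, i, hi⟩ := Fintype.not_linearIndependent_iff.1 h
  simp only [Fin.sum_univ_three, cons_val_zero, cons_val_one, cons_val_two, tail_cons, head_cons] at hg
  -- `hg : g 0 • 1 + g 1 • X + g 2 • X ^ 2 = 0`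
  by_cases h2 : g 2 = 0
  · by_cases h1 : g 1 = 0
    · exfalso
      rw [h1, h2, zero_smul, zero_smul, add_zero, add_zero, smul_one_eq_zero_iff] at hg
      fin_cases i
      · exact hi hg
      · exact hi h1
      · exact hi h2
    · -- `X` scalar
      rw [h2, zero_smul, add_zero, add_comm] at hg
      exact exists_mul_sub_eq_zero_of_eq_smul_one (eq_smul_one_of_smul_add_smul_one_eq_zero h1 hg)
  · -- normalise to a monic quadratic
    apply exists_mul_sub_eq_zero_of_sq_add X (g 1 / g 2) (g 0 / g 2)
    have := congr_arg (fun M : Matrix (Fin 3) (Fin 3) K => (g 2)⁻¹ • M) hg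
    simp only [smul_add, smul_smul, smul_zero, inv_mul_cancel₀ h2, one_smul] at this
    rw [div_eq_inv_mul, div_eq_inv_mul, ← this]
    abel

/-- The road's spelling: **`X` is REGULAR (`1, X, X²` independent) iff it satisfies no quadratic relation `(X − a)(X − b) = 0`**. [cite: HornJohnson2013, Thm. 3.3.15] -/
theorem not_exists_mul_sub_eq_zero_iff_linearIndependent (X : Matrix (Fin 3) (Fin 3) K) :
    (¬ ∃ a b : K, (X - a • (1 : Matrix (Fin 3) (Fin 3) K)) * (X - b • (1 : Matrix (Fin 3) (Fin 3) K)) = 0) ↔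
      LinearIndependent K ![(1 : Matrix (Fin 3) (Fin 3) K), X, X ^ 2] := by
  rw [exists_mul_sub_eq_zero_iff_not_linearIndependent, not_not]

/-- **The three gradients `∇tr = 1`, `∇E₂ = tr X·1 − X`, `∇det = adj X` are independent iff `1, X, X²` are** (unitriangular change of family by §1's
`adj X = X² − tr X·X + E₂·1`). [cite: HornJohnson2013, §0.8.10 (0.8.10.1); §1.2 (1.2.13)] -/
theorem linearIndependent_gradients_iff (X : Matrix (Fin 3) (Fin 3) K) :
    LinearIndependent K ![(1 : Matrix (Fin 3) (Fin 3) K), trace X • (1 : Matrix (Fin 3) (Fin 3) K) - X, adjugate X] ↔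
      LinearIndependent K ![(1 : Matrix (Fin 3) (Fin 3) K), X, X ^ 2] := by
  have hadj := adjugate_eq_sq_sub_trace_smul_add X
  set t := trace X with ht
  set e := trace (adjugate X) with he
  rw [Fintype.linearIndependent_iff, Fintype.linearIndependent_iff]
  constructor
  · intro hA g hg
    simp only [Fin.sum_univ_three, cons_val_zero, cons_val_one, cons_val_two, tail_cons, head_cons] at hg
    -- rewrite the `B`-relation in the `A`-family
    have hA' := hA ![g 0 + g 1 * t + g 2 * (t ^ 2 - e), -g 1 - g 2 * t, g 2] (by
      simp only [Fin.sum_univ_three, cons_val_zero, cons_val_one, cons_val_two, tail_cons, head_cons]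
      rw [hadj, ← hg]
      module)
    have h2 : g 2 = 0 := by simpa using hA' 2
    have h1 : g 1 = 0 := by simpa [h2] using hA' 1
    have h0 : g 0 = 0 := by simpa [h1, h2] using hA' 0
    intro i; fin_cases i <;> assumption
  · intro hB g hg
    simp only [Fin.sum_univ_three, cons_val_zero, cons_val_one, cons_val_two, tail_cons, head_cons] at hg
    have hB' := hB ![g 0 + g 1 * t + g 2 * e, -g 1 - g 2 * t, g 2] (by
      simp only [Fin.sum_univ_three, cons_val_zero, cons_val_one, cons_val_two, tail_cons, head_cons]
      rw [← hg, hadj]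
      module)
    have h2 : g 2 = 0 := by simpa using hB' 2
    have h1 : g 1 = 0 := by simpa [h2] using hB' 1
    have h0 : g 0 = 0 := by simpa [h1, h2] using hB' 0
    intro i; fin_cases i <;> assumption

/-! ## §3 The differential `L_X(Y) = (tr Y, tr X·tr Y − tr (XY), tr (adj X·Y))` is onto `K³` iff `X` is regular -/

/-- **The trace pairing on `M₃(K)` is perfect**: `tr (M Y) = 0` for all `Y` forces `M = 0` (test against the matrix units). [cite: HornJohnson2013, §0.8.10 (0.8.10.1)] -/
theorem eq_zero_of_forall_trace_mul_eq_zero {M : Matrix (Fin 3) (Fin 3) K} (h : ∀ Y : Matrix (Fin 3) (Fin 3) K, trace (M * Y) = 0) : M = 0 := by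
  ext i j
  have hij := h (Matrix.single j i 1)
  rw [trace_mul_single, MulOpposite.op_one, one_smul] at hij
  exact hij

/-- A linear combination of the three pairings is the pairing against the linear combination of the gradients. [cite: HornJohnson2013, §0.8.10 (0.8.10.1)] -/
theorem combination_eq_trace_mul (X Y : Matrix (Fin 3) (Fin 3) K) (c₀ c₁ c₂ : K) :
    c₀ * trace Y + c₁ * (trace X * trace Y - trace (X * Y)) + c₂ * trace (adjugate X * Y) =
      trace ((c₀ • (1 : Matrix (Fin 3) (Fin 3) K) + c₁ • (trace X • (1 : Matrix (Fin 3) (Fin 3) K) - X) + c₂ • adjugate X) * Y) := by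
  rw [← trace_trace_smul_one_sub_mul, add_mul, add_mul, smul_mul_assoc, smul_mul_assoc, smul_mul_assoc, one_mul, trace_add, trace_add, trace_smul,
    trace_smul, trace_smul, smul_eq_mul, smul_eq_mul, smul_eq_mul]

/-- **Onto ⇒ the gradients are independent.** [cite: HornJohnson2013, Thm. 3.3.15] -/
theorem linearIndependent_gradients_of_surjective {X : Matrix (Fin 3) (Fin 3) K}
    (h : Function.Surjective (fun Y : Matrix (Fin 3) (Fin 3) K => (trace Y, trace X * trace Y - trace (X * Y), trace (adjugate X * Y)))) :
    LinearIndependent K ![(1 : Matrix (Fin 3) (Fin 3) K), trace X • (1 : Matrix (Fin 3) (Fin 3) K) - X, adjugate X] := by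
  rw [Fintype.linearIndependent_iff]
  intro g hg
  simp only [Fin.sum_univ_three, cons_val_zero, cons_val_one, cons_val_two, tail_cons, head_cons] at hg
  have hpair : ∀ Y : Matrix (Fin 3) (Fin 3) K, g 0 * trace Y + g 1 * (trace X * trace Y - trace (X * Y)) + g 2 * trace (adjugate X * Y) = 0 := by
    intro Y; rw [combination_eq_trace_mul, hg, zero_mul, trace_zero]
  obtain ⟨Y₀, hY₀⟩ := h (1, 0, 0)
  obtain ⟨Y₁, hY₁⟩ := h (0, 1, 0)
  obtain ⟨Y₂, hY₂⟩ := h (0, 0, 1)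
  simp only [Prod.mk.injEq] at hY₀ hY₁ hY₂
  have h0 := hpair Y₀; rw [hY₀.2.1, hY₀.2.2, hY₀.1] at h0
  have h1 := hpair Y₁; rw [hY₁.2.1, hY₁.2.2, hY₁.1] at h1
  have h2 := hpair Y₂; rw [hY₂.2.1, hY₂.2.2, hY₂.1] at h2
  simp only [mul_one, mul_zero, add_zero, zero_add] at h0 h1 h2
  intro i; fin_cases i <;> assumption

/-- **Independent gradients ⇒ onto** (the perfect trace pairing: a proper range lies in the kernel of a nonzero functional `(c₀, c₁, c₂)`, whose pull-back
`Y ↦ tr ((c₀·1 + c₁(tr X·1 − X) + c₂ adj X) Y)` then vanishes, so `c₀·1 + c₁(tr X·1 − X) + c₂ adj X = 0`). [cite: HornJohnson2013, Thm. 3.3.15] -/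
theorem surjective_of_linearIndependent_gradients {X : Matrix (Fin 3) (Fin 3) K}
    (hli : LinearIndependent K ![(1 : Matrix (Fin 3) (Fin 3) K), trace X • (1 : Matrix (Fin 3) (Fin 3) K) - X, adjugate X]) :
    Function.Surjective (fun Y : Matrix (Fin 3) (Fin 3) K => (trace Y, trace X * trace Y - trace (X * Y), trace (adjugate X * Y))) := by
  -- the differential as a linear map
  let Λ : Matrix (Fin 3) (Fin 3) K →ₗ[K] K × K × K :=
    (traceLinearMap (Fin 3) K K).prod
      (((traceLinearMap (Fin 3) K K).comp (LinearMap.mulLeft K (trace X • (1 : Matrix (Fin 3) (Fin 3) K) - X))).prod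
        ((traceLinearMap (Fin 3) K K).comp (LinearMap.mulLeft K (adjugate X))))
  have hΛ : ∀ Y, Λ Y = (trace Y, trace X * trace Y - trace (X * Y), trace (adjugate X * Y)) := by
    intro Y
    change (trace Y, trace ((trace X • (1 : Matrix (Fin 3) (Fin 3) K) - X) * Y), trace (adjugate X * Y)) = _
    rw [trace_trace_smul_one_sub_mul]
  suffices hsurj : Function.Surjective Λ by
    intro w
    obtain ⟨Y, hY⟩ := hsurj w
    exact ⟨Y, (hΛ Y).symm.trans hY⟩
  rw [← LinearMap.range_eq_top]
  by_contra hne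
  obtain ⟨f, hf0, hf⟩ := Submodule.exists_le_ker_of_lt_top _ (lt_top_iff_ne_top.2 hne)
  have hfΛ : ∀ Y, f (Λ Y) = 0 := fun Y => hf (LinearMap.mem_range_self Λ Y)
  -- the coefficients of `f`
  have hf_apply : ∀ w : K × K × K, f w = w.1 * f (1, 0, 0) + w.2.1 * f (0, 1, 0) + w.2.2 * f (0, 0, 1) := by
    intro w
    have hw : w = w.1 • ((1 : K), (0 : K), (0 : K)) + w.2.1 • ((0 : K), (1 : K), (0 : K)) + w.2.2 • ((0 : K), (0 : K), (1 : K)) := by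
      ext <;> simp
    conv_lhs => rw [hw]
    rw [map_add, map_add, map_smul, map_smul, map_smul, smul_eq_mul, smul_eq_mul, smul_eq_mul]
  have hM : f (1, 0, 0) • (1 : Matrix (Fin 3) (Fin 3) K) + f (0, 1, 0) • (trace X • (1 : Matrix (Fin 3) (Fin 3) K) - X) + f (0, 0, 1) • adjugate X = 0 := by
    apply eq_zero_of_forall_trace_mul_eq_zero
    intro Y
    rw [← combination_eq_trace_mul, mul_comm (f (1, 0, 0)), mul_comm (f (0, 1, 0)), mul_comm (f (0, 0, 1))]
    have := hfΛ Y
    rw [hf_apply, hΛ] at this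
    exact this
  have hc := Fintype.linearIndependent_iff.1 hli ![f (1, 0, 0), f (0, 1, 0), f (0, 0, 1)]
    (by simpa only [Fin.sum_univ_three, cons_val_zero, cons_val_one, cons_val_two, tail_cons, head_cons] using hM)
  have hc0 : f (1, 0, 0) = 0 := by simpa using hc 0
  have hc1 : f (0, 1, 0) = 0 := by simpa using hc 1
  have hc2 : f (0, 0, 1) = 0 := by simpa using hc 2
  apply hf0
  refine LinearMap.ext fun w => ?_
  rw [hf_apply, hc0, hc1, hc2, mul_zero, mul_zero, mul_zero, add_zero, add_zero, LinearMap.zero_apply]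

/-- **KOSTANT'S CRITERION for `M₃`**: the differential of the Chevalley map at `X` is surjective iff `1, X, X²` are linearly independent.
[cite: HornJohnson2013, §0.8.10 (0.8.10.1); Thm. 3.3.15] -/
theorem surjective_differential_iff (X : Matrix (Fin 3) (Fin 3) K) :
    Function.Surjective (fun Y : Matrix (Fin 3) (Fin 3) K => (trace Y, trace X * trace Y - trace (X * Y), trace (adjugate X * Y))) ↔
      LinearIndependent K ![(1 : Matrix (Fin 3) (Fin 3) K), X, X ^ 2] := by
  rw [← linearIndependent_gradients_iff]
  exact ⟨linearIndependent_gradients_of_surjective, surjective_of_linearIndependent_gradients⟩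

/-- **Trace-zero slice** (`𝔰𝔩₃`-directions): every `(c, d) ∈ K²` is `(tr X·tr Y − tr (XY), tr (adj X·Y))` for some `Y` with `tr Y = 0` iff `1, X, X²` are independent
(`K·1` is the annihilator of the trace-zero matrices under the trace pairing). [cite: HornJohnson2013, §0.8.10 (0.8.10.1); Thm. 3.3.15] -/
theorem forall_exists_trace_zero_differential_iff (X : Matrix (Fin 3) (Fin 3) K) :
    (∀ c d : K, ∃ Y : Matrix (Fin 3) (Fin 3) K, trace Y = 0 ∧ trace X * trace Y - trace (X * Y) = c ∧ trace (adjugate X * Y) = d) ↔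
      LinearIndependent K ![(1 : Matrix (Fin 3) (Fin 3) K), X, X ^ 2] := by
  constructor
  · intro h
    rw [← linearIndependent_gradients_iff, Fintype.linearIndependent_iff]
    intro g hg
    simp only [Fin.sum_univ_three, cons_val_zero, cons_val_one, cons_val_two, tail_cons, head_cons] at hg
    have hpair : ∀ Y : Matrix (Fin 3) (Fin 3) K, g 0 * trace Y + g 1 * (trace X * trace Y - trace (X * Y)) + g 2 * trace (adjugate X * Y) = 0 := by
      intro Y; rw [combination_eq_trace_mul, hg, zero_mul, trace_zero]
    obtain ⟨Y₁, hY₁0, hY₁c, hY₁d⟩ := h 1 0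
    obtain ⟨Y₂, hY₂0, hY₂c, hY₂d⟩ := h 0 1
    have h1 := hpair Y₁; rw [hY₁c, hY₁d, hY₁0] at h1
    have h2 := hpair Y₂; rw [hY₂c, hY₂d, hY₂0] at h2
    simp only [mul_one, mul_zero, add_zero, zero_add] at h1 h2
    rw [h1, h2, zero_smul, zero_smul, add_zero, add_zero, smul_one_eq_zero_iff] at hg
    intro i; fin_cases i <;> assumption
  · intro hli c d
    obtain ⟨Y, hY⟩ := (surjective_differential_iff X).2 hli (0, c, d)
    simp only [Prod.mk.injEq] at hY
    exact ⟨Y, hY.1, hY.2.1, hY.2.2⟩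

end Field

end Literature.LinearAlgebra.Matrix.CubicChevalleyDifferential
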